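/-
Copyright (c) 2026 the pub-hodgecm-mathlib formalisation cell (harness21).  Prover seat hodgecm-mathlib-A-p12 (g35): P6b wave A seat 1 «FFGS-QUOT» (A), §E
part 1 «BASE CHANGE OF THE COACTION ALONG A (FLAT) ALGEBRA OVER THE INVARIANTS» (dealer desk F0P6b-plan (g13) DEAL P6b-A1, director g34 s1734; box
F0P6-ref1 (g8)), 2026-09-03.
-/
import Literature.AlgebraicGeometry.GroupSchemes.FiniteFlatGroupSchemeQuotientAffineBasisCriterion
import Mathlib.LinearAlgebra.TensorProduct.Tower
import Mathlib.RingTheory.Flat.Equalizer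
import HarnessLib

/-!
# Quotient of an affine scheme by a finite locally free group scheme, §E.1: base change of the coaction over the invariants

Topic `AlgebraicGeometry/GroupSchemes`; namespace `Literature.AlgebraicGeometry.GroupSchemes.FiniteFlatQuotientAffine` (sub-namespace = the object:
the affine quotient `X ⧸ Z = Spec C₀` of [MumfordAV1970] §12 Thm. 1 ∕ [SGA3I] Exp. V Thm. 4.1 ∕ [StacksProject] Tag 03BM); THEOREMS ONLY (no definition,
instance, notation or named fact); Mathlib-footed.  Cell `pub/hodgecm-mathlib` (D-0151), organ «FFGS-QUOT» (A) (desk F0P6b-plan (g13) sheet §0; signature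
sheet `WAVEA-SIGNATURES.v2` `sig_FFGSQ_A_torsorOverInvariants`), lane `--supports stmt-HodgeConjecture-24832`; count-neutral (banked Row-4B capital).
HC_CM is proved only modulo the printed citations (2 remaining named inputs hLiu418 = `stmt-HodgeConjecture-24832`, h413 = `stmt-HodgeConjecture-24833`)
until rung 0 closes.

THE SETTING.  `ρ : C →ₐ[R] C ⊗[R] H` a coaction (the sheet's `hcoassoc` ∕ `hcounit` ∕ `hfree` appear as hypotheses of the individual results); `C₀ ≤ C` an
`R`-subalgebra of invariants (`hC₀ : ∀ b ∈ C₀, ρ b = b ⊗ 1`; for the comparison of invariants also `hC₀' : ρ c = c ⊗ 1 → c ∈ C₀`, i.e.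
`C₀ = AlgHom.equalizer ρ includeLeft`); `B` a commutative `C₀`-algebra (compatibly an `R`-algebra).  The base change is `C' := B ⊗[C₀] C` with the coaction
`ρ' : C' →ₐ[R] C' ⊗[R] H`, `ρ' (b ⊗ c) = assoc⁻¹ (b ⊗ ρ c)` — this is [StacksProject] Tag 03BK (Lemma 39.23.5 (1): «the maps `s, t, c` induce maps `s', t', c'` such
that `(U', R', s', t', c')` is a groupoid scheme», base change of the groupoid `X × Z ⇉ X` along `Spec B → Spec C₀ = M`) written for the action groupoid.

THE RESULTS (all about ANY `ρ'` satisfying the pure-tensor formula `hρ'`, so that they compose freely):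
* `exists_coaction_baseChange` — existence of such an `R`-ALGEBRA map `ρ'` (constructed as `assoc⁻¹ ∘ (id_B ⊗ ρ₀)` with `ρ₀` the `C₀`-linear coaction,
  Mathlib `Algebra.TensorProduct.assoc R C₀ B B C H` + `Algebra.TensorProduct.map`);
* `coaction_baseChange_tmul_eq_sum`, `coaction_baseChange_one_tmul`, `coaction_baseChange_tmul_one` — pointwise formulae (`ρ' (1 ⊗ c) = (includeRight ⊗ id)(ρ c)`,
  `ρ' (b ⊗ 1) = (b ⊗ 1) ⊗ 1`);
* `coassoc_coaction_baseChange`, `counit_coaction_baseChange` — `ρ'` is coassociative and counital in the sheet's element-wise form (Tag 03BK (1));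
* `surjective_productMap_coaction_baseChange` — the base-changed action is FREE (`θ'` onto) when `θ` is (base change of the closed immersion `j`);
* `equalizer_coaction_baseChange_eq_range` — for `B` FLAT over `C₀ = C^{co H}` the invariants of `ρ'` are exactly `B ⊗ 1` ([StacksProject] Tag 03BK (3) «if
  `C → C'` is flat then `C' ≅ C₁`», Mathlib `AlgHom.tensorEqualizerEquiv`).
§E.2 (`FiniteFlatGroupSchemeQuotientAffine.lean`) takes `B = C₀[X]_{𝔪[X]}` (flat, local, infinite residue field), runs §D there and descends.

## References
* [StacksProject] The Stacks Project, Tag 03BK (Lemma 39.23.5: base change of a finite flat groupoid on an affine scheme along `C → C'`; (3) invariants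
  commute with flat base change), Tag 03BM.
* [MumfordAV1970] D. Mumford, *Abelian Varieties* (1970), §12 Thm. 1 (A), proof pp. 112–115.
* [SGA3I] M. Demazure, A. Grothendieck (eds.), *SGA 3, Tome I*, Exp. V, Thm. 4.1.
-/

set_option autoImplicit false

namespace Literature.AlgebraicGeometry.GroupSchemes.FiniteFlatQuotientAffine

open TensorProduct Algebra.TensorProduct

/-! ## §E.1  Base change of the coaction along `C₀ → B` -/

section BaseChange

variable {R : Type*} [CommRing R] {H : Type*} [CommRing H] [HopfAlgebra R H]
  {C : Type*} [CommRing C] [Algebra R C] (ρ : C →ₐ[R] C ⊗[R] H)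
  (C₀ : Subalgebra R C) (hC₀ : ∀ b ∈ C₀, ρ b = b ⊗ₜ[R] (1 : H))
  (B : Type*) [CommRing B] [Algebra R B] [Algebra C₀ B] [IsScalarTower R C₀ B]

include hC₀ in
/-- The coaction commutes with the structure maps of a subalgebra of invariants `C₀`: `ρ (algebraMap C₀ C b) = algebraMap C₀ (C ⊗ H) b`, i.e. `ρ` is a
`C₀`-ALGEBRA map (the groupoid maps `s, t` are maps over `M = Spec C₀`, [StacksProject] Tag 03BK). [cite: StacksProject, Tag 03BK] -/
theorem coaction_commutes_subalgebra (b : C₀) :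
    ρ (algebraMap C₀ C b) = algebraMap C₀ (C ⊗[R] H) b := by
  change ρ (b : C) = (b : C) ⊗ₜ[R] (1 : H)
  exact hC₀ b b.2

include hC₀ in
/-- **The base-changed coaction exists**: for a `C₀`-algebra `B` there is an `R`-algebra map `ρ' : B ⊗[C₀] C → (B ⊗[C₀] C) ⊗[R] H` with
`ρ' (b ⊗ c) = assoc⁻¹ (b ⊗ ρ c)`, namely `assoc⁻¹ ∘ (id_B ⊗ ρ₀)` ([StacksProject] Tag 03BK (1): «the maps `s, t, c` induce maps `s', t', c'`»).
[cite: StacksProject, Tag 03BK] -/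
theorem exists_coaction_baseChange :
    ∃ ρ' : B ⊗[C₀] C →ₐ[R] (B ⊗[C₀] C) ⊗[R] H,
      ∀ (b : B) (c : C), ρ' (b ⊗ₜ[C₀] c) =
        (TensorProduct.AlgebraTensorModule.assoc R C₀ B B C H).symm (b ⊗ₜ[C₀] ρ c) := by
  let ρ₀ : C →ₐ[C₀] C ⊗[R] H :=
    { ρ.toRingHom with commutes' := fun b => coaction_commutes_subalgebra ρ C₀ hC₀ b }
  have hρ₀ : ∀ c, ρ₀ c = ρ c := fun c => rfl
  let m : B ⊗[C₀] C →ₐ[B] B ⊗[C₀] (C ⊗[R] H) := Algebra.TensorProduct.map (AlgHom.id B B) ρ₀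
  let a : (B ⊗[C₀] C) ⊗[R] H ≃ₐ[B] B ⊗[C₀] (C ⊗[R] H) := Algebra.TensorProduct.assoc R C₀ B B C H
  let ρB : B ⊗[C₀] C →ₐ[B] (B ⊗[C₀] C) ⊗[R] H := a.symm.toAlgHom.comp m
  refine ⟨ρB.restrictScalars R, fun b c => ?_⟩
  change a.symm (m (b ⊗ₜ[C₀] c)) = _
  rw [Algebra.TensorProduct.map_tmul, AlgHom.id_apply, hρ₀]
  rfl

variable (ρ' : B ⊗[C₀] C →ₐ[R] (B ⊗[C₀] C) ⊗[R] H)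
  (hρ' : ∀ (b : B) (c : C), ρ' (b ⊗ₜ[C₀] c) =
    (TensorProduct.AlgebraTensorModule.assoc R C₀ B B C H).symm (b ⊗ₜ[C₀] ρ c))

include hρ' in
/-- Pointwise formula for the base-changed coaction against an expansion `ρ c = Σ cₖ ⊗ hₖ`: `ρ' (b ⊗ c) = Σ (b ⊗ cₖ) ⊗ hₖ`. [cite: StacksProject, Tag 03BK] -/
theorem coaction_baseChange_tmul_eq_sum (b : B) (c : C) (s : Finset (C × H))
    (hs : ρ c = ∑ p ∈ s, p.1 ⊗ₜ[R] p.2) :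
    ρ' (b ⊗ₜ[C₀] c) = ∑ p ∈ s, (b ⊗ₜ[C₀] p.1) ⊗ₜ[R] p.2 := by
  rw [hρ', hs, tmul_sum, map_sum]
  simp only [TensorProduct.AlgebraTensorModule.assoc_symm_tmul]

include hρ' in
/-- `ρ' (1 ⊗ c) = (includeRight ⊗ id)(ρ c)`: the base-changed coaction extends `ρ` along `C → B ⊗[C₀] C` (the square `t ∘ (U' → U) = (R' → R) ∘ t'` of
[StacksProject] Tag 03BK). [cite: StacksProject, Tag 03BK] -/
theorem coaction_baseChange_one_tmul (c : C) :
    ρ' ((1 : B) ⊗ₜ[C₀] c) = Algebra.TensorProduct.map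
      (Algebra.TensorProduct.includeRight : C →ₐ[C₀] B ⊗[C₀] C) (AlgHom.id R H) (ρ c) := by
  obtain ⟨s, hs⟩ := TensorProduct.exists_finset (R := R) (ρ c)
  rw [coaction_baseChange_tmul_eq_sum ρ C₀ B ρ' hρ' 1 c s hs, hs, map_sum]
  simp only [Algebra.TensorProduct.map_tmul, AlgHom.id_apply, Algebra.TensorProduct.includeRight_apply]

include hρ' in
/-- `ρ' (b ⊗ 1) = (b ⊗ 1) ⊗ 1`: the elements of `B` are invariant after base change. [cite: StacksProject, Tag 03BK] -/
theorem coaction_baseChange_tmul_one (b : B) :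
    ρ' (b ⊗ₜ[C₀] (1 : C)) = (b ⊗ₜ[C₀] (1 : C)) ⊗ₜ[R] (1 : H) := by
  have h1 : ρ 1 = (1 : C) ⊗ₜ[R] (1 : H) := by rw [map_one]; rfl
  rw [coaction_baseChange_tmul_eq_sum ρ C₀ B ρ' hρ' b 1 {((1 : C), (1 : H))} (by simp [h1])]
  simp

include hρ' in
/-- **The base-changed coaction is COASSOCIATIVE** (in the signature sheet's element-wise form), for any `ρ'` with the pure-tensor formula: on `b ⊗ c`
both `(id ⊗ Δ)(ρ' –)` and `assoc ((ρ' ⊗ id)(ρ' –))` are the reassociation `c ⊗ w ↦ (b ⊗ c) ⊗ w` applied to the two sides of `hcoassoc c` ([StacksProject]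
Tag 03BK (1): `(U', R', s', t', c')` is again a groupoid). [cite: StacksProject, Tag 03BK] -/
theorem coassoc_coaction_baseChange
    (hcoassoc : ∀ c : C, TensorProduct.map LinearMap.id (Coalgebra.comul (R := R) (A := H)) (ρ c) =
      TensorProduct.assoc R C H H (TensorProduct.map ρ.toLinearMap LinearMap.id (ρ c)))
    (z : B ⊗[C₀] C) :
    TensorProduct.map LinearMap.id (Coalgebra.comul (R := R) (A := H)) (ρ' z) =
      TensorProduct.assoc R (B ⊗[C₀] C) H H (TensorProduct.map ρ'.toLinearMap LinearMap.id (ρ' z)) := by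
  -- the reassociation `Φ_b : C ⊗ (H ⊗ H) → (B ⊗ C) ⊗ (H ⊗ H)`, `c ⊗ w ↦ (b ⊗ c) ⊗ w`
  have key : ∀ (b : B) (c : C),
      TensorProduct.map LinearMap.id (Coalgebra.comul (R := R) (A := H)) (ρ' (b ⊗ₜ[C₀] c)) =
      TensorProduct.assoc R (B ⊗[C₀] C) H H (TensorProduct.map ρ'.toLinearMap LinearMap.id (ρ' (b ⊗ₜ[C₀] c))) := by
    intro b c
    let Φ : C ⊗[R] (H ⊗[R] H) →ₗ[R] (B ⊗[C₀] C) ⊗[R] (H ⊗[R] H) :=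
      TensorProduct.map ((TensorProduct.mk C₀ B C b).restrictScalars R) LinearMap.id
    have hΦ : ∀ (c : C) (w : H ⊗[R] H), Φ (c ⊗ₜ[R] w) = (b ⊗ₜ[C₀] c) ⊗ₜ[R] w := fun c w => rfl
    -- Lemma A
    have hA : ∀ y : C ⊗[R] H, TensorProduct.map LinearMap.id (Coalgebra.comul (R := R) (A := H))
        ((TensorProduct.AlgebraTensorModule.assoc R C₀ B B C H).symm (b ⊗ₜ[C₀] y)) =
        Φ (TensorProduct.map LinearMap.id (Coalgebra.comul (R := R) (A := H)) y) := by
      intro y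
      induction y using TensorProduct.induction_on with
      | zero => simp
      | tmul c h =>
          simp only [TensorProduct.AlgebraTensorModule.assoc_symm_tmul, TensorProduct.map_tmul, LinearMap.id_apply, hΦ]
      | add u v hu hv => simp only [tmul_add, map_add, hu, hv]
    -- Lemma B
    have hB : ∀ y : C ⊗[R] H, TensorProduct.assoc R (B ⊗[C₀] C) H H
        (TensorProduct.map ρ'.toLinearMap LinearMap.id
          ((TensorProduct.AlgebraTensorModule.assoc R C₀ B B C H).symm (b ⊗ₜ[C₀] y))) =
        Φ (TensorProduct.assoc R C H H (TensorProduct.map ρ.toLinearMap LinearMap.id y)) := by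
      intro y
      induction y using TensorProduct.induction_on with
      | zero => simp
      | tmul c h =>
          obtain ⟨s, hs⟩ := TensorProduct.exists_finset (R := R) (ρ c)
          simp only [TensorProduct.AlgebraTensorModule.assoc_symm_tmul, TensorProduct.map_tmul, LinearMap.id_apply,
            AlgHom.toLinearMap_apply]
          rw [coaction_baseChange_tmul_eq_sum ρ C₀ B ρ' hρ' b c s hs, hs, sum_tmul, sum_tmul, map_sum, map_sum,
            map_sum]
          refine Finset.sum_congr rfl fun q _ => ?_
          rw [TensorProduct.assoc_tmul, TensorProduct.assoc_tmul, hΦ]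
      | add u v hu hv => simp only [tmul_add, map_add, hu, hv]
    rw [hρ' b c, hA, hcoassoc c, ← hB, ← hρ' b c]
  induction z using TensorProduct.induction_on with
  | zero => simp
  | tmul b c => exact key b c
  | add u v hu hv => simp only [map_add, hu, hv]

include hρ' in
/-- **The base-changed coaction is COUNITAL** (the sheet's element-wise form): `rid ((id ⊗ ε)(ρ' (b ⊗ c))) = b ⊗ rid ((id ⊗ ε)(ρ c)) = b ⊗ c`.
[cite: StacksProject, Tag 03BK] -/
theorem counit_coaction_baseChange
    (hcounit : ∀ c : C, TensorProduct.rid R C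
      (TensorProduct.map LinearMap.id (Coalgebra.counit (R := R) (A := H)) (ρ c)) = c)
    (z : B ⊗[C₀] C) :
    TensorProduct.rid R (B ⊗[C₀] C)
      (TensorProduct.map LinearMap.id (Coalgebra.counit (R := R) (A := H)) (ρ' z)) = z := by
  have hC : ∀ (b : B) (y : C ⊗[R] H), TensorProduct.rid R (B ⊗[C₀] C)
      (TensorProduct.map LinearMap.id (Coalgebra.counit (R := R) (A := H))
        ((TensorProduct.AlgebraTensorModule.assoc R C₀ B B C H).symm (b ⊗ₜ[C₀] y))) =
      b ⊗ₜ[C₀] (TensorProduct.rid R C (TensorProduct.map LinearMap.id (Coalgebra.counit (R := R) (A := H)) y)) := by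
    intro b y
    induction y using TensorProduct.induction_on with
    | zero => simp
    | tmul c h =>
        rw [TensorProduct.AlgebraTensorModule.assoc_symm_tmul, TensorProduct.map_tmul, TensorProduct.map_tmul,
          LinearMap.id_apply, LinearMap.id_apply, TensorProduct.rid_tmul, TensorProduct.rid_tmul, tmul_smul]
    | add u v hu hv => simp only [tmul_add, map_add, hu, hv]
  induction z using TensorProduct.induction_on with
  | zero => simp
  | tmul b c => rw [hρ' b c, hC, hcounit c]
  | add u v hu hv => simp only [map_add, hu, hv]

include hρ' in
/-- **The base-changed action is FREE**: if the Galois map `θ = includeLeft ⊗ ρ` of `C` is onto, so is that of `B ⊗[C₀] C` — its range is a subalgebra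
containing `(b ⊗ 1) ⊗ 1 = θ' ((b ⊗ 1) ⊗ 1)` and `(1 ⊗ c) ⊗ h = (includeRight ⊗ id)(θ v) = θ' ((includeRight ⊗ includeRight) v)`, which generate (base change of
the closed immersion `j : R → U ×_S U`, [StacksProject] Tag 03BK ∕ 03BM). [cite: StacksProject, Tag 03BK] -/
theorem surjective_productMap_coaction_baseChange
    (hfree : Function.Surjective
      (Algebra.TensorProduct.productMap (Algebra.TensorProduct.includeLeft : C →ₐ[R] C ⊗[R] H) ρ)) :
    Function.Surjective (Algebra.TensorProduct.productMap (S := (B ⊗[C₀] C) ⊗[R] H)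
      Algebra.TensorProduct.includeLeft ρ') := by
  set θ' := Algebra.TensorProduct.productMap (S := (B ⊗[C₀] C) ⊗[R] H)
      Algebra.TensorProduct.includeLeft ρ' with hθ'
  set ι := Algebra.TensorProduct.map
      (Algebra.TensorProduct.includeRight : C →ₐ[C₀] B ⊗[C₀] C) (AlgHom.id R H) with hι
  -- `ι (θ v) ∈ range θ'`
  have h1 : ∀ v : C ⊗[R] C, ι (Algebra.TensorProduct.productMap
      (Algebra.TensorProduct.includeLeft : C →ₐ[R] C ⊗[R] H) ρ v) ∈ θ'.range := by
    intro v
    induction v using TensorProduct.induction_on with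
    | zero => simp
    | tmul a c =>
        have : θ' (((1 : B) ⊗ₜ[C₀] a) ⊗ₜ[R] ((1 : B) ⊗ₜ[C₀] c)) = ι (Algebra.TensorProduct.productMap
            (Algebra.TensorProduct.includeLeft : C →ₐ[R] C ⊗[R] H) ρ (a ⊗ₜ[R] c)) := by
          rw [hθ', productMap_apply_tmul, productMap_apply_tmul, map_mul, hι,
            coaction_baseChange_one_tmul ρ C₀ B ρ' hρ' c, Algebra.TensorProduct.includeLeft_apply,
            Algebra.TensorProduct.includeLeft_apply, Algebra.TensorProduct.map_tmul, map_one,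
            Algebra.TensorProduct.includeRight_apply]
        exact ⟨_, this⟩
    | add u v hu hv => rw [map_add, map_add]; exact θ'.range.add_mem hu hv
  have h2 : ∀ (c : C) (h : H), (((1 : B) ⊗ₜ[C₀] c) ⊗ₜ[R] h) ∈ θ'.range := by
    intro c h
    obtain ⟨v, hv⟩ := hfree (c ⊗ₜ[R] h)
    have : ι (c ⊗ₜ[R] h) = ((1 : B) ⊗ₜ[C₀] c) ⊗ₜ[R] h := by
      rw [hι, Algebra.TensorProduct.map_tmul, AlgHom.id_apply, Algebra.TensorProduct.includeRight_apply]
    rw [← this, ← hv]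
    exact h1 v
  have h3 : ∀ b : B, ((b ⊗ₜ[C₀] (1 : C)) ⊗ₜ[R] (1 : H)) ∈ θ'.range := fun b => by
    have : θ' ((b ⊗ₜ[C₀] (1 : C)) ⊗ₜ[R] 1) = (b ⊗ₜ[C₀] (1 : C)) ⊗ₜ[R] (1 : H) := by
      rw [hθ', productMap_left_apply, Algebra.TensorProduct.includeLeft_apply]
    exact ⟨_, this⟩
  intro w
  suffices hw : w ∈ θ'.range by exact hw
  induction w using TensorProduct.induction_on with
  | zero => exact θ'.range.zero_mem
  | tmul z h =>
      induction z using TensorProduct.induction_on with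
      | zero => simp
      | tmul b c =>
          have : (b ⊗ₜ[C₀] c) ⊗ₜ[R] h = ((b ⊗ₜ[C₀] (1 : C)) ⊗ₜ[R] (1 : H)) * (((1 : B) ⊗ₜ[C₀] c) ⊗ₜ[R] h) := by
            rw [Algebra.TensorProduct.tmul_mul_tmul, Algebra.TensorProduct.tmul_mul_tmul, mul_one, one_mul, one_mul]
          rw [this]
          exact θ'.range.mul_mem (h3 b) (h2 c h)
      | add u v hu hv => rw [add_tmul]; exact θ'.range.add_mem hu hv
  | add u v hu hv => exact θ'.range.add_mem hu hv

include hρ' hC₀ in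
/-- **Invariants commute with FLAT base change** ([StacksProject] Tag 03BK (3): «if `C → C'` is flat then `φ : C' → C₁` is an isomorphism»): if `C₀` is
the FULL ring of invariants (`hC₀'`) and `B` is flat over `C₀`, the invariants `AlgHom.equalizer ρ' includeLeft` of the base change are exactly the image
`B ⊗ 1` of `B` (Mathlib `AlgHom.tensorEqualizerEquiv`: `B ⊗[C₀] eq(ρ₀, ι₀) ⥲ eq(id ⊗ ρ₀, id ⊗ ι₀)`, transported through `assoc`). [cite: StacksProject, Tag 03BK] -/
theorem equalizer_coaction_baseChange_eq_range [Module.Flat C₀ B]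
    (hC₀' : ∀ c : C, ρ c = c ⊗ₜ[R] (1 : H) → c ∈ C₀) :
    AlgHom.equalizer ρ' (Algebra.TensorProduct.includeLeft : B ⊗[C₀] C →ₐ[R] (B ⊗[C₀] C) ⊗[R] H) =
      (IsScalarTower.toAlgHom R B (B ⊗[C₀] C)).range := by
  apply le_antisymm
  swap
  · rintro _ ⟨b, rfl⟩
    rw [AlgHom.mem_equalizer]
    change ρ' (algebraMap B (B ⊗[C₀] C) b) = (algebraMap B (B ⊗[C₀] C) b) ⊗ₜ[R] (1 : H)
    rw [Algebra.TensorProduct.algebraMap_apply, Algebra.algebraMap_self, RingHom.id_apply,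
      coaction_baseChange_tmul_one ρ C₀ B ρ' hρ' b]
  intro z hz
  rw [AlgHom.mem_equalizer, Algebra.TensorProduct.includeLeft_apply] at hz
  -- the `C₀`-linear coaction and inclusion
  let ρ₀ : C →ₐ[C₀] C ⊗[R] H :=
    { ρ.toRingHom with commutes' := fun b => coaction_commutes_subalgebra ρ C₀ hC₀ b }
  have hρ₀ : ∀ c, ρ₀ c = ρ c := fun c => rfl
  let ι₀ : C →ₐ[C₀] C ⊗[R] H := Algebra.TensorProduct.includeLeft
  let aA : (B ⊗[C₀] C) ⊗[R] H ≃ₐ[B] B ⊗[C₀] (C ⊗[R] H) := Algebra.TensorProduct.assoc R C₀ B B C H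
  have hm : ∀ w : B ⊗[C₀] C, aA (ρ' w) = Algebra.TensorProduct.map (AlgHom.id B B) ρ₀ w := by
    intro w
    induction w using TensorProduct.induction_on with
    | zero => simp only [map_zero]
    | tmul b c =>
        rw [hρ' b c, Algebra.TensorProduct.map_tmul, AlgHom.id_apply, hρ₀]
        exact (TensorProduct.AlgebraTensorModule.assoc R C₀ B B C H).apply_symm_apply _
    | add u v hu hv => simp only [map_add, hu, hv]
  have hn : ∀ w : B ⊗[C₀] C, aA (w ⊗ₜ[R] (1 : H)) = Algebra.TensorProduct.map (AlgHom.id B B) ι₀ w := by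
    intro w
    induction w using TensorProduct.induction_on with
    | zero => simp only [zero_tmul, map_zero]
    | tmul b c =>
        rw [Algebra.TensorProduct.map_tmul, AlgHom.id_apply]
        rfl
    | add u v hu hv => simp only [add_tmul, map_add, hu, hv]
  have hz' : Algebra.TensorProduct.map (AlgHom.id B B) ρ₀ z = Algebra.TensorProduct.map (AlgHom.id B B) ι₀ z := by
    rw [← hm, ← hn, hz]
  have hzE : z ∈ AlgHom.equalizer (Algebra.TensorProduct.map (AlgHom.id B B) ρ₀)
      (Algebra.TensorProduct.map (AlgHom.id B B) ι₀) := (AlgHom.mem_equalizer _ _ _).2 hz'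
  set e := AlgHom.tensorEqualizerEquiv B B ρ₀ ι₀ with he
  obtain ⟨t, ht⟩ := e.surjective ⟨z, hzE⟩
  have hzt : z = Algebra.TensorProduct.map (AlgHom.id B B) (AlgHom.equalizer ρ₀ ι₀).val t := by
    have := congr_arg Subtype.val ht
    rw [he, AlgHom.tensorEqualizerEquiv_apply, AlgHom.coe_tensorEqualizer] at this
    exact this.symm
  rw [hzt]
  clear hzt ht hzE hz' hz
  induction t using TensorProduct.induction_on with
  | zero => simp
  | tmul b y =>
      have hyC₀ : (y : C) ∈ C₀ := hC₀' y ((AlgHom.mem_equalizer _ _ _).1 y.2)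
      refine ⟨(⟨(y : C), hyC₀⟩ : C₀) • b, ?_⟩
      change algebraMap B (B ⊗[C₀] C) ((⟨(y : C), hyC₀⟩ : C₀) • b) = _
      rw [Algebra.TensorProduct.algebraMap_apply, Algebra.algebraMap_self, RingHom.id_apply,
        Algebra.TensorProduct.map_tmul, AlgHom.id_apply, Subalgebra.coe_val, TensorProduct.smul_tmul]
      congr 1
      rw [Algebra.smul_def, mul_one]
      rfl
  | add u v hu hv => rw [map_add]; exact Subalgebra.add_mem _ hu hv

end BaseChange

end Literature.AlgebraicGeometry.GroupSchemes.FiniteFlatQuotientAffine
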